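import Summits.QuantumFields.BalabanUV.Beta.GAN24.GaugeReadLabelSums
import Summits.QuantumFields.BalabanUV.Beta.GAN24.KernelLegCharges

/-!
# `BalabanUV.Beta.GAN24.GaugeReadCharge` — binder row G-an2-4 / (CONV-C), CT-W «WC-TL», (Q-R) «QR-LL», the OWNER gan24-p1's R11 ∕ g26 W2 CHARGE AUDIT of the
# σ-letters, piece (γ) = the response (gauge-read) letter: **ITS LIVE CHARGE (double-leg sum) FACTORISES — stencil charges × weight masses — and the weight mass IS the
# response read of the response kernel's COLUMN PROFILE** (identity level; the zero ∕ displayed alternatives are then `GaugeReadLayerForm` §3 ∕ §2)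
# (G-an2-4 formalisation swarm, unit `b2b-balaban-gan24-formalise-leaf-06`, gen 44; INTENT 3).

NOT IN PRINT; OUR BOOKKEEPING ([folklore] Fubini bookkeeping over this lineage's gen-8 `KernelLegCharges.hasSum_prod_wsum` ∕ `summable_prod_of_biLoc` and gen-44
`GaugeReadLabelSums.abs_read_le ∕ abs_read_term_le` BY NAME).  HONEST FRAMING (cell contract, verbatim): «discharging `BetaPertH` makes Bałaban's UV stability UNCONDITIONAL — a
real constructive-QFT result; it is NOT the continuum limit and NOT the Clay problem.»  HONEST DEPENDENCY (verbatim): «continuum YM on T⁴ ⇐ BetaPertH ∧ nine spine estimates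
(0/9 proved); BetaPertH ⇐ (D1) ∧ (D4) ∧ CAP+tail; G-an2-4 gates asym, D1 and NE2/3/4.»  No cited fact, no `def`, no `def … : Prop`, 0 sorry.
* §1 `hasSum_prod_wsum_fine` (the `N = 1` reading of `KernelLegCharges.hasSum_prod_wsum`: the double-leg sum of `wsum w S` is `Σ'_u w u · Z(S u)`),
  **`hasSum_prod_gaugeSup`** — THE LIVE CHARGE OF THE RESPONSE PIECE `𝒢[A](g)` (an1's `wsum`∕`cwsum` shape, any weight `|g| ≤ 1`): `Σ_{(x,z)} 𝒢(x,z)(a,b) =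
  Σ_κ Σ'_u w_κ(u)·Z(S κ u)(a,b) + Σ_ρ Σ'_y w′_ρ(y)·Z(M ρ y)(a,b)`, `Z(K) := Σ'_{(x,z)} K x z a b`, `w_κ(u) = Σ'_{x₂} Σ_κ₂ A u x₂ (inl κ)(inl κ₂)·g κ₂ x₂`.
* §2 **`tsum_read_eq_read_colProfile`** — THE WEIGHT MASS IS THE READ OF THE COLUMN PROFILE: `Σ'_u w(u) = Σ'_{x₂} Σ_κ₂ (Σ'_u A u x₂ a (inl κ₂))·g κ₂ x₂` (Fubini on the
  absolutely summable family `(u, x₂) ↦ A u x₂ · g`).  With `g := ĝ_T` the union weight: ZERO when the column profile is `N`-periodic (`GaugeReadLayerForm.sum_read_gaugeWt_eq_zero_of_periodic`),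
  the DISPLAYED boundary flux of `GaugeReadLayerForm.sum_read_gaugeWt_eq_layers` otherwise — (γ) is CHARGE-DISPLAYED, zero-charge NOT claimed.
Asserts NO value of any stencil charge `Z(S κ u)`; decides nothing about (LT) ∕ K-LL-3; NEVER «G-an2-4 closed» as (CONV-C); NOT D1, NOT BetaPertH, NOT continuum, NOT Clay.  2026-08-22.
-/

noncomputable section

open Finset
open scoped BigOperators
open Literature.MathematicalPhysics.QuantumFieldTheory
open Literature.MathematicalPhysics.QuantumFieldTheory.Balaban1983to89
open Literature.MathematicalPhysics.QuantumFieldTheory.Balaban1983to89.Beta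
open B12Sec2to5 (l1 l1_nonneg)
open ExpKernelCalculus (Site MKer Decays BiLoc VertexFamily Zl Zl_nonneg summable_exp_shift')
open OneStepResolventKernel (Fib wsum LocStencil)
open InterLevelTransport (cwsum cwsum_apply)
open Summit.QuantumFields.BalabanUV.Beta.GAN24.KernelLegCharges (hasSum_prod_wsum)
open Summit.QuantumFields.BalabanUV.Beta.GAN24.GaugeReadLabelSums (abs_read_le abs_read_term_le)

namespace Summit.QuantumFields.BalabanUV.Beta.GAN24.GaugeReadCharge

variable {d : ℕ}

/-! ## §1 The live charge of the response piece factorises: stencil charges × weight masses -/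

/-- [folklore] **THE DOUBLE-LEG SUM OF A FINE-INDEXED SUPERPOSITION** (`KernelLegCharges.hasSum_prod_wsum` read at `N = 1`): weights decaying from `p`, kernels
bi-localised at their own index ⇒ `Σ_{(x,z)} (wsum w S) x z a b = Σ'_u w u · Σ'_{(x,z)} S u x z a b`. -/
theorem hasSum_prod_wsum_fine {w : Site (d + 1) → ℝ} {S : Site (d + 1) → MKer (d + 1) (Fib d)} {C δ Cs δs : ℝ} {p : Site (d + 1)}
    (hw : ∀ u, |w u| ≤ C * Real.exp (-δ * l1 (u - p))) (hδ : 0 < δ) (hS : ∀ u, BiLoc (S u) u u Cs δs) (hδs : 0 < δs) (a b : Fib d) :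
    HasSum (fun xz : Site (d + 1) × Site (d + 1) => wsum w S xz.1 xz.2 a b)
      (∑' u, w u * ∑' xz : Site (d + 1) × Site (d + 1), S u xz.1 xz.2 a b) := by
  have hw' : ∀ u, |w u| ≤ C * Real.exp (-δ * l1 (((1 : ℕ) : ℤ) • u - p)) := fun u => by
    simpa only [Nat.cast_one, one_smul] using hw u
  have hS' : ∀ u, BiLoc (S u) (((1 : ℕ) : ℤ) • u) (((1 : ℕ) : ℤ) • u) Cs δs := fun u => by
    simpa only [Nat.cast_one, one_smul] using hS u
  have h := hasSum_prod_wsum (N := 1) le_rfl hw' hδ hS' hδs a b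
  simpa only [OneStepResolventKernel.wsum] using h

/-- [folklore] **THE LIVE CHARGE OF THE RESPONSE PIECE FACTORISES** (`A` bi-localised at `(p, q)`, rate `δ > 0`; `|g κ x| ≤ 1`; `LocStencil S Cs δ`, `VertexFamily M N CM δ`,
`1 ≤ N`): the double-leg sum of an1's response piece `𝒢[A](g) = Σ_κ wsum (u ↦ w_κ u) (S κ) + Σ_ρ cwsum N (y ↦ w′_ρ y) (M ρ)` (weights = the reads of `A` against `g`) is
`Σ_κ Σ'_u w_κ(u)·Z(S κ u) + Σ_ρ Σ'_y w′_ρ(y)·Z(M ρ y)`, `Z(K) = Σ'_{(x,z)} K x z a b` — the STENCIL CHARGES weighted by the read weights.  Nothing here makes any `Z` vanish. -/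
theorem hasSum_prod_gaugeSup {A : MKer (d + 1) (Fib d)} {p q : Site (d + 1)} {C δ : ℝ} (hA : BiLoc A p q C δ) (hδ : 0 < δ)
    {g : Fin (d + 1) → Site (d + 1) → ℝ} (hg : ∀ κ x, |g κ x| ≤ 1) {N : ℕ} [NeZero N] (hN : 1 ≤ N)
    {S : Fin (d + 1) → Site (d + 1) → MKer (d + 1) (Fib d)} {Cs : ℝ} (hS : LocStencil S Cs δ)
    {M : Fin (d + 1) → Site (d + 1) → MKer (d + 1) (Fib d)} {CM : ℝ} (hM : VertexFamily M N CM δ) (a b : Fib d) :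
    HasSum (fun xz : Site (d + 1) × Site (d + 1) =>
        (∑ κ, wsum (fun u => ∑' x₂, ∑ κ₂, A u x₂ (Sum.inl κ) (Sum.inl κ₂) * g κ₂ x₂) (S κ)
          + ∑ ρ, cwsum N (fun y => ∑' x₂, ∑ κ₂, A ((N : ℤ) • y) x₂ (Sum.inr ρ) (Sum.inl κ₂) * g κ₂ x₂) (M ρ)) xz.1 xz.2 a b)
      (∑ κ, ∑' u, (∑' x₂, ∑ κ₂, A u x₂ (Sum.inl κ) (Sum.inl κ₂) * g κ₂ x₂) * ∑' xz : Site (d + 1) × Site (d + 1), S κ u xz.1 xz.2 a b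
        + ∑ ρ, ∑' y, (∑' x₂, ∑ κ₂, A ((N : ℤ) • y) x₂ (Sum.inr ρ) (Sum.inl κ₂) * g κ₂ x₂) * ∑' xz : Site (d + 1) × Site (d + 1), M ρ y xz.1 xz.2 a b) := by
  -- the read weights decay from `p` (an1's constant), fine and coarse
  have h1 : ∀ κ : Fin (d + 1), HasSum (fun xz : Site (d + 1) × Site (d + 1) =>
      wsum (fun u => ∑' x₂, ∑ κ₂, A u x₂ (Sum.inl κ) (Sum.inl κ₂) * g κ₂ x₂) (S κ) xz.1 xz.2 a b)
      (∑' u, (∑' x₂, ∑ κ₂, A u x₂ (Sum.inl κ) (Sum.inl κ₂) * g κ₂ x₂) * ∑' xz : Site (d + 1) × Site (d + 1), S κ u xz.1 xz.2 a b) := fun κ =>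
    hasSum_prod_wsum_fine (fun u => abs_read_le hA hδ hg u (Sum.inl κ)) hδ (fun u => hS κ u) hδ a b
  have h2 : ∀ ρ : Fin (d + 1), HasSum (fun xz : Site (d + 1) × Site (d + 1) =>
      cwsum N (fun y => ∑' x₂, ∑ κ₂, A ((N : ℤ) • y) x₂ (Sum.inr ρ) (Sum.inl κ₂) * g κ₂ x₂) (M ρ) xz.1 xz.2 a b)
      (∑' y, (∑' x₂, ∑ κ₂, A ((N : ℤ) • y) x₂ (Sum.inr ρ) (Sum.inl κ₂) * g κ₂ x₂) * ∑' xz : Site (d + 1) × Site (d + 1), M ρ y xz.1 xz.2 a b) := by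
    intro ρ
    have h := hasSum_prod_wsum hN (fun y => abs_read_le hA hδ hg ((N : ℤ) • y) (Sum.inr ρ)) hδ (fun y => hM ρ y) hδ a b
    have e : (fun xz : Site (d + 1) × Site (d + 1) =>
        cwsum N (fun y => ∑' x₂, ∑ κ₂, A ((N : ℤ) • y) x₂ (Sum.inr ρ) (Sum.inl κ₂) * g κ₂ x₂) (M ρ) xz.1 xz.2 a b)
        = fun xz => ∑' y, (∑' x₂, ∑ κ₂, A ((N : ℤ) • y) x₂ (Sum.inr ρ) (Sum.inl κ₂) * g κ₂ x₂) * M ρ y xz.1 xz.2 a b :=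
      funext fun xz => cwsum_apply _ (M ρ) xz.1 xz.2 a b
    rw [e]
    exact h
  have hsum := (hasSum_sum fun κ (_ : κ ∈ (Finset.univ : Finset (Fin (d + 1)))) => h1 κ).add
    (hasSum_sum fun ρ (_ : ρ ∈ (Finset.univ : Finset (Fin (d + 1)))) => h2 ρ)
  refine hsum.congr_fun fun xz => ?_
  simp only [Pi.add_apply, Finset.sum_apply]

/-! ## §2 The weight mass is the read of the column profile (Fubini) -/

/-- [folklore] The scalar family `(u, x₂) ↦ Σ_κ₂ A u x₂ a (inl κ₂)·g κ₂ x₂` of a bi-localised `A` against a weight of sup ≤ 1 is absolutely summable on the product. -/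
theorem summable_prod_read {A : MKer (d + 1) (Fib d)} {p q : Site (d + 1)} {C δ : ℝ} (hA : BiLoc A p q C δ) (hδ : 0 < δ)
    {g : Fin (d + 1) → Site (d + 1) → ℝ} (hg : ∀ κ x, |g κ x| ≤ 1) (a : Fib d) :
    Summable fun ux : Site (d + 1) × Site (d + 1) => ∑ κ₂, A ux.1 ux.2 a (Sum.inl κ₂) * g κ₂ ux.2 := by
  -- the product majorant `(d+1)·C·e^{−δ|u−p|₁}·e^{−δ|x₂−q|₁}`
  have h1 : Summable fun u : Site (d + 1) => Real.exp (-δ * l1 (u - p)) := summable_exp_shift' hδ p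
  have h2 : Summable fun x : Site (d + 1) => Real.exp (-δ * l1 (x - q)) := summable_exp_shift' hδ q
  have hprod : Summable fun ux : Site (d + 1) × Site (d + 1) =>
      ((d + 1 : ℕ) * C) * (Real.exp (-δ * l1 (ux.1 - p)) * Real.exp (-δ * l1 (ux.2 - q))) :=
    (h1.mul_of_nonneg h2 (fun _ => (Real.exp_pos _).le) (fun _ => (Real.exp_pos _).le)).mul_left _
  refine Summable.of_norm_bounded hprod (fun ux => ?_)
  rw [Real.norm_eq_abs]
  have h := abs_read_term_le hA hg ux.1 ux.2 a
  calc |∑ κ₂, A ux.1 ux.2 a (Sum.inl κ₂) * g κ₂ ux.2| ≤ ((d + 1 : ℕ) * C * Real.exp (-δ * l1 (ux.1 - p))) * Real.exp (-δ * l1 (ux.2 - q)) := h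
    _ = ((d + 1 : ℕ) * C) * (Real.exp (-δ * l1 (ux.1 - p)) * Real.exp (-δ * l1 (ux.2 - q))) := by ring

/-- [folklore] **THE WEIGHT MASS IS THE READ OF THE COLUMN PROFILE**: for `A` bi-localised at `(p, q)` (rate `δ > 0`) and `|g κ x| ≤ 1`,
`Σ'_u (Σ'_{x₂} Σ_κ₂ A u x₂ a (inl κ₂)·g κ₂ x₂) = Σ'_{x₂} Σ_κ₂ (Σ'_u A u x₂ a (inl κ₂))·g κ₂ x₂` — the total mass of the read weights is the response read (in the sense of
`GaugeReadLabelSums` §4) of the COLUMN PROFILE `x₂ ↦ Σ'_u A u x₂ a (inl κ₂)` against the same weight.  With `g := ĝ_T` this is the object whose vanishing ∕ boundary-flux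
form `GaugeReadLayerForm` §3 ∕ §2 decide. -/
theorem tsum_read_eq_read_colProfile {A : MKer (d + 1) (Fib d)} {p q : Site (d + 1)} {C δ : ℝ} (hA : BiLoc A p q C δ) (hδ : 0 < δ)
    {g : Fin (d + 1) → Site (d + 1) → ℝ} (hg : ∀ κ x, |g κ x| ≤ 1) (a : Fib d) :
    ∑' u, (∑' x₂, ∑ κ₂, A u x₂ a (Sum.inl κ₂) * g κ₂ x₂) = ∑' x₂, ∑ κ₂, (∑' u, A u x₂ a (Sum.inl κ₂)) * g κ₂ x₂ := by
  have hs : Summable (Function.uncurry fun (u : Site (d + 1)) (x₂ : Site (d + 1)) => ∑ κ₂, A u x₂ a (Sum.inl κ₂) * g κ₂ x₂) :=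
    summable_prod_read hA hδ hg a
  -- Fubini
  have hcomm : ∑' x₂, ∑' u, ∑ κ₂, A u x₂ a (Sum.inl κ₂) * g κ₂ x₂ = ∑' u, (∑' x₂, ∑ κ₂, A u x₂ a (Sum.inl κ₂) * g κ₂ x₂) := hs.tsum_comm
  rw [← hcomm]
  refine tsum_congr fun x₂ => ?_
  -- each column `u ↦ A u x₂ a (inl κ₂)` is summable (decay from `p`)
  have hcol : ∀ κ₂ : Fin (d + 1), Summable fun u => A u x₂ a (Sum.inl κ₂) * g κ₂ x₂ := fun κ₂ => by
    refine Summable.of_norm_bounded (((summable_exp_shift' hδ p).mul_left (C * Real.exp (-δ * l1 (x₂ - q)))).mul_right |g κ₂ x₂|) (fun u => ?_)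
    rw [Real.norm_eq_abs, abs_mul]
    refine mul_le_mul_of_nonneg_right ?_ (abs_nonneg _)
    have h := hA u x₂ a (Sum.inl κ₂)
    calc |A u x₂ a (Sum.inl κ₂)| ≤ C * Real.exp (-δ * (l1 (u - p) + l1 (x₂ - q))) := h
      _ = C * Real.exp (-δ * l1 (x₂ - q)) * Real.exp (-δ * l1 (u - p)) := by rw [mul_add, Real.exp_add]; ring
  rw [Summable.tsum_finsetSum (fun κ₂ _ => hcol κ₂)]
  exact Finset.sum_congr rfl fun κ₂ _ => by rw [tsum_mul_right]

end Summit.QuantumFields.BalabanUV.Beta.GAN24.GaugeReadCharge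

end
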